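/-
Copyright (c) 2026 the pub-hodgecm-mathlib formalisation cell (harness21).  Prover seat hodgecm-mathlib-LH4-p10 (g8) (valve hand, K1-a♮ line,
line lead K2E5-p16 (g8)): Track B «K2-LIT», hLiu418 = stmt-HodgeConjecture-24832; LEAD F0P6-plan (g14) BATCH #94 (d); file (W) of the (K1a-3) cut.
-/
import Summits.HodgeConjecture.HodgeConjecture.Theorems.K2LiuSiegelIntertwiningCocycle         -- ★ B4d-3 (+ ★ B4-abs `integrable_of_iterated`)
import HarnessLib

/-!
# Crux `HLiu418`, road `K2_Liu`, line K1-a♮ (the singular big-cell term), file (W) of the (K1a-3) cut: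
# THE WEIGHTED COCYCLE — the Siegel intertwining integral of `H_v = U(2,2)(F_v)` with a weight on the OUTER coordinate, as an iterated rank-one integral

Cell `hodgecm-mathlib`, crux item hLiu418 = `stmt-HodgeConjecture-24832`; squad K2 (valve hand LH4-p10 (g8) from F0∕P3c∕LH4); line lead K2E5-p16 (g8).
THEOREMS ONLY (no `def`, no instance, no notation, no named-fact hypothesis, no `sorry`); lane `--supports stmt-HodgeConjecture-24832`
(count-neutral helper).  ONE FRAME (RULING M-156o (c)): the concrete letters are ★ B4d-3's, token for token.

THE POINT.  The rank-one (corner-twisted) big-cell integral of the K1-a♮ line (line lead memo `CENSUS-K1a-GK` §1, WORD #2 (σ)) is the Siegel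
intertwining integral `∫_{N_Δ(F_v)} f(φ(w_Δ^J) u h) dνN(u)` of ★ B4d-3 with the integrand multiplied by a unimodular weight `W(b₁(u))`
(`W = conj ψ_v(σ·)`) depending ONLY on the first coordinate `b₁ = (e⁻¹ u).1` of ★ B1b-2b's coordinates `e(b₁, z, b₂)` — the OUTERMOST variable
of ★ B4d-3's iterated integral `c · ∫_x ∫_z ∫_y`.  So the cocycle carries the weight for free: the change of variables is the same, the weight is
constant in the two inner integrals, and `‖W‖ ≤ 1` keeps every integrability of the unweighted `|f|`-chain (★ B4-abs `integrable_of_iterated`).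
Both (K1a-3) heads (non-split `K2LiuRankOneSingularLocalRegularity`, K2E3-p29 (g2); split `…Split`, this seat) feed their ★ B7-M2 ∕ B7-M2s
majorant chains to §2 VERBATIM.
* §1 (group-abstract, ★ B4-abs letters + `W`): `integral_comp_eq_iterated_weighted`, `integral_comp_eq_iterated_of_chain_weighted` —
  `∫_N W((coord⁻¹ n).1) f(w_Δ ι(n) h) dνN = c · ∫_x W(x) ∫_z ∫_y f(A(y) B(z) C(x) h)`, with integrability on `N`.
* §2 (concrete, ★ B4d-3 letters + `W`): `integral_frameConj_weylSiegel_eq_iterated_of_chain_weighted` — for `W : F_v → ℂ` continuous with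
  `‖W x‖ ≤ 1` and the three `|f|`-chain integrabilities of ★ B4d-3,
  `∫_{N_Δ} W((e⁻¹u).1) f(φ(w_Δ^J) u h) dνN(u) = c · ∫_x W(x) ∫_z ∫_y f(φ(w₂)φ(u_{2e₂}(ι_v(y)δ)) · (φ(w₁)φ(u_{e₁−e₂}(z)) · (φ(w₂)φ(u_{2e₂}(ι_v(x)δ)) · h)))`.
HONEST LABEL.  `HC_CM` is proved only modulo the 7 printed citations (2 remaining named inputs: hLiu418 = `stmt-HodgeConjecture-24832`,
h413 = `stmt-HodgeConjecture-24833`) until rung 0 closes.  Count-neutral helper; states no law, pays no socket.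

## References
* [Casselman1980] W. Casselman, *The unramified principal series of p-adic groups I*, Compositio Math. 40 (1980), §3 Thm. 3.1 (the cocycle along `s₂ s₁ s₂`).
* [KudlaRallis1994] S. Kudla, S. Rallis, *A regularized Siegel–Weil formula: the first term identity*, Ann. of Math. 140 (1994), §2 (singular
  Fourier coefficients of the Siegel Eisenstein series through the rank-one intertwining chain).
* [HarrisKudlaSweet1996] M. Harris, S. Kudla, W. J. Sweet, J. AMS 9 (1996), §6 (6.14)–(6.16).
* [Weil1965] A. Weil, Acta Math. 113 (1965), §37 (Haar measures in coordinates).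
-/

set_option autoImplicit false
set_option linter.dupNamespace false -- the mandated namespace repeats `HodgeConjecture.HodgeConjecture`

noncomputable section

open NumberField IsDedekindDomain Matrix MeasureTheory
open scoped NNReal ENNReal
open Literature.NumberTheory.Automorphic Literature.NumberTheory.Automorphic.UnitaryGroup
open Literature.NumberTheory.GelbartRogawski1991.AdaptedBlocks
open Literature.NumberTheory.GelbartRogawski1991.UnitaryDualPair.LocalSplitting
open Literature.NumberTheory.K2Lit.LocalSiegelDoubled
open Summit.HodgeConjecture.HodgeConjecture.Cruxes.HLiu418.K2LiuLocalSiegelIwasawaFrame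
open Summit.HodgeConjecture.HodgeConjecture.Cruxes.HLiu418.K2LiuLocalSiegelIwasawa
open Summit.HodgeConjecture.HodgeConjecture.Cruxes.HLiu418.K2LiuDoubledUTwoTwoBorelFrame
open Summit.HodgeConjecture.HodgeConjecture.Cruxes.HLiu418.K2LiuDoubledUTwoTwoWeylCocycle
open Summit.HodgeConjecture.HodgeConjecture.Cruxes.HLiu418.K2LiuDoubledUTwoTwoFrameTransport
open Summit.HodgeConjecture.HodgeConjecture.Cruxes.HLiu418.K2LiuDoubledUTwoTwoUnipotentCoordinates
open Summit.HodgeConjecture.HodgeConjecture.Cruxes.HLiu418.K2LiuDoubledUTwoTwoUnipotentHaar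
open Summit.HodgeConjecture.HodgeConjecture.Cruxes.HLiu418.K2LiuUnipDeltaRankOneCoordinates
open Summit.HodgeConjecture.HodgeConjecture.Cruxes.HLiu418.K2LiuIteratedRankOneCocycle
open Summit.HodgeConjecture.HodgeConjecture.Cruxes.HLiu418.K2LiuSiegelIntertwiningCocycle

namespace Summit.HodgeConjecture.HodgeConjecture.Cruxes.HLiu418.K2LiuSiegelIntertwiningCocycleWeighted

/-! ## §1 The weighted cocycle, group-abstract (★ B4-abs letters + a weight on the outer coordinate) -/

section Abstract

variable {H : Type*} [Group H] {N X Zm Yi : Type*} [MeasurableSpace N] [MeasurableSpace X] [MeasurableSpace Zm] [MeasurableSpace Yi]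
  (νN : Measure N) (μX : Measure X) (μZ : Measure Zm) (μY : Measure Yi) [SFinite μX] [SFinite μZ] [SFinite μY]
  (ι : N → H) (coord : X × (Zm × Yi) ≃ᵐ N) (c : ℝ≥0∞) (wΔ : H) (A : Yi → H) (B : Zm → H) (C : X → H)

/-- **THE WEIGHTED ITERATED COCYCLE.**  If `νN = c • map coord (μX ⊗ μZ ⊗ μY)` and `w_Δ · ι(coord(x,z,y)) = A(y) B(z) C(x)`, then for every `f`, `h`
with `p ↦ f(A(p.2.2) (B(p.2.1) (C(p.1) h)))` integrable on the product and every measurable weight `W : X → ℂ` with `‖W‖ ≤ 1`,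
`∫_N W((coord⁻¹ n).1) · f(w_Δ · ι n · h) dνN = c · ∫_x W(x) · ∫_z ∫_y f(A(y) (B(z) (C(x) h))) dμY dμZ dμX` — the weight rides on the OUTER variable.
[cite: Casselman1980, §3 Thm. 3.1] [cite: KudlaRallis1994, §2] -/
theorem integral_comp_eq_iterated_weighted (hν : νN = c • Measure.map coord (μX.prod (μZ.prod μY)))
    (hword : ∀ (x : X) (z : Zm) (y : Yi), wΔ * ι (coord (x, (z, y))) = A y * B z * C x)
    (f : H → ℂ) (h : H) (W : X → ℂ) (hWm : Measurable W) (hW1 : ∀ x, ‖W x‖ ≤ 1)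
    (hint : Integrable (fun p : X × (Zm × Yi) => f (A p.2.2 * (B p.2.1 * (C p.1 * h)))) (μX.prod (μZ.prod μY))) :
    ∫ n, W (coord.symm n).1 * f (wΔ * ι n * h) ∂νN = (c.toReal : ℂ) * ∫ x, W x * ∫ z, ∫ y, f (A y * (B z * (C x * h))) ∂μY ∂μZ ∂μX := by
  rw [hν, integral_smul_measure, integral_map_equiv]
  have hfun : (fun p : X × (Zm × Yi) => W (coord.symm (coord p)).1 * f (wΔ * ι (coord p) * h)) =
      fun p => W p.1 * f (A p.2.2 * (B p.2.1 * (C p.1 * h))) := by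
    funext p
    rcases p with ⟨x, z, y⟩
    show W (coord.symm (coord (x, (z, y)))).1 * f (wΔ * ι (coord (x, (z, y))) * h) = _
    rw [coord.symm_apply_apply, hword x z y, mul_assoc, mul_assoc]
  have hintW : Integrable (fun p : X × (Zm × Yi) => W p.1 * f (A p.2.2 * (B p.2.1 * (C p.1 * h)))) (μX.prod (μZ.prod μY)) :=
    hint.bdd_mul (hWm.comp measurable_fst).aestronglyMeasurable (Filter.Eventually.of_forall fun p => hW1 p.1)
  rw [hfun, integral_prod _ hintW, Complex.real_smul]
  congr 1
  refine integral_congr_ae ?_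
  filter_upwards [hint.prod_right_ae] with x hx
  show ∫ q, W x * f (A q.2 * (B q.1 * (C x * h))) ∂(μZ.prod μY) = W x * ∫ z, ∫ y, f (A y * (B z * (C x * h))) ∂μY ∂μZ
  rw [integral_const_mul, integral_prod _ hx]

/-- **Weighted cocycle + integrability packaged** (the `|f|`-chain of ★ B4-abs `integrable_of_iterated` dominates the weighted integrand since `‖W‖ ≤ 1`).
[cite: Casselman1980, §3 Thm. 3.1] [cite: KudlaRallis1994, §2] -/
theorem integral_comp_eq_iterated_of_chain_weighted (hν : νN = c • Measure.map coord (μX.prod (μZ.prod μY))) (hc : c ≠ ∞)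
    (hword : ∀ (x : X) (z : Zm) (y : Yi), wΔ * ι (coord (x, (z, y))) = A y * B z * C x)
    (f : H → ℂ) (h : H) (W : X → ℂ) (hWm : Measurable W) (hW1 : ∀ x, ‖W x‖ ≤ 1)
    (hmeas : AEStronglyMeasurable (fun p : X × (Zm × Yi) => f (A p.2.2 * (B p.2.1 * (C p.1 * h)))) (μX.prod (μZ.prod μY)))
    (hI1 : ∀ g : H, Integrable (fun y => ‖f (A y * g)‖) μY)
    (hI2 : ∀ g' : H, Integrable (fun z => ∫ y, ‖f (A y * (B z * g'))‖ ∂μY) μZ)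
    (hI3 : Integrable (fun x => ∫ z, ∫ y, ‖f (A y * (B z * (C x * h)))‖ ∂μY ∂μZ) μX) :
    Integrable (fun n => W (coord.symm n).1 * f (wΔ * ι n * h)) νN ∧
      ∫ n, W (coord.symm n).1 * f (wΔ * ι n * h) ∂νN = (c.toReal : ℂ) * ∫ x, W x * ∫ z, ∫ y, f (A y * (B z * (C x * h))) ∂μY ∂μZ ∂μX := by
  have hint := integrable_of_iterated μX μZ μY A B C f h hmeas hI1 hI2 hI3
  refine ⟨?_, integral_comp_eq_iterated_weighted νN μX μZ μY ι coord c wΔ A B C hν hword f h W hWm hW1 hint⟩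
  rw [hν]
  refine Integrable.smul_measure ?_ hc
  rw [integrable_map_equiv]
  have hfun : ((fun n => W (coord.symm n).1 * f (wΔ * ι n * h)) ∘ coord) = fun p : X × (Zm × Yi) => W p.1 * f (A p.2.2 * (B p.2.1 * (C p.1 * h))) := by
    funext p
    rcases p with ⟨x, z, y⟩
    show W (coord.symm (coord (x, (z, y)))).1 * f (wΔ * ι (coord (x, (z, y))) * h) = _
    rw [coord.symm_apply_apply, hword x z y, mul_assoc, mul_assoc]
  rw [hfun]
  exact hint.bdd_mul (hWm.comp measurable_fst).aestronglyMeasurable (Filter.Eventually.of_forall fun p => hW1 p.1)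

end Abstract

/-! ## §2 The weighted cocycle in `H_v` (★ B4d-3 letters + a weight on `b₁`) -/

section Concrete

variable (F : Type) [Field F] [NumberField F] (E : Type) [Field E] [NumberField E] [Algebra F E]
  [Algebra.IsQuadraticExtension F E] (c : E ≃ₐ[F] E)
  {δ : E} (hcδ : c δ = -δ) (hδ : δ ≠ 0) (v : HeightOneSpectrum (𝓞 F))
  {T₂ : Matrix (Fin 2) (Fin 2) F} {J₂D : Matrix (Fin (2 + 2)) (Fin (2 + 2)) E} (hJ₂D : J₂D = (gramD F 2 T₂).map (algebraMap F E))
  (Q : GL (Fin (2 + 2)) F)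
  (hQ : (Q : Matrix (Fin (2 + 2)) (Fin (2 + 2)) F)ᵀ * gramD F 2 T₂ * (Q : Matrix (Fin (2 + 2)) (Fin (2 + 2)) F) = (StdForm.antidiagonal (2 + 2)).over F)
  [MeasurableSpace (v.adicCompletion F)] [BorelSpace (v.adicCompletion F)] [SecondCountableTopology (v.adicCompletion F)]
  [MeasurableSpace (UnitaryGroup.LocalRing E v)] [BorelSpace (UnitaryGroup.LocalRing E v)] [SecondCountableTopology (UnitaryGroup.LocalRing E v)]
  [MeasurableSpace (unipDeltaLocal F E c v 2 (JD := J₂D))] [BorelSpace (unipDeltaLocal F E c v 2 (JD := J₂D))]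

include hcδ hδ in
/-- **THE WEIGHTED SIEGEL INTERTWINING INTEGRAL AS AN ITERATED RANK-ONE INTEGRAL.**  In the letters of ★ B4d-3
`integral_frameConj_weylSiegel_eq_iterated_of_chain` (coordinates `e(b₁, z, b₂)` of ★ B1b-2b, `νN = c • map e (μ_F ⊗ μ_R ⊗ μ_F)`, the three `|f|`-chain
integrabilities `hI1 hI2 hI3`), and for a continuous weight `W : F_v → ℂ` with `‖W x‖ ≤ 1` put on the first coordinate `b₁ = (e⁻¹ u).1`:
the weighted integrand is integrable on `N_Δ(F_v)` and
`∫_{N_Δ} W((e⁻¹u).1) · f(φ(w_Δ^J) u h) dνN(u) = c · ∫_x W(x) ∫_z ∫_y f(φ(w₂)φ(u(ι(y)δ)) · (φ(w₁)φ(u₋(z)) · (φ(w₂)φ(u(ι(x)δ)) · h)))` — the weight sits on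
the OUTERMOST integral (the K1-a♮ corner twist `W = conj ψ_v(σ·)`). [cite: Casselman1980, §3 Thm. 3.1] [cite: KudlaRallis1994, §2] [cite: HarrisKudlaSweet1996, §6 (6.14)] -/
theorem integral_frameConj_weylSiegel_eq_iterated_of_chain_weighted
    (e : (v.adicCompletion F × UnitaryGroup.LocalRing E v × v.adicCompletion F) ≃ₜ unipDeltaLocal F E c v 2 (JD := J₂D))
    (he : ∀ b₁ z b₂, ((e (b₁, z, b₂) : unipDeltaLocal F E c v 2 (JD := J₂D)) : UnitaryGroup.localPi E c (2 + 2) J₂D v) =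
      FrameTransport.frameConj F E c v (2 + 2) hJ₂D (antidiagonal_over_eq_map F E 2) Q hQ
          (toLocalFour F E c v (nSiegel (UnitaryGroup.LocalRing E v) (UnitaryGroup.conjLocal E c v) (UnitaryGroup.conjLocal_conjLocal c v hcδ hδ)
            (UnitaryGroup.toLocalRing E v b₁ * algebraMap E (UnitaryGroup.LocalRing E v) δ) z
            (UnitaryGroup.toLocalRing E v b₂ * algebraMap E (UnitaryGroup.LocalRing E v) δ)
            (conjLocal_coord F E c hcδ v b₁) (conjLocal_coord F E c hcδ v b₂))))
    (νN : Measure (unipDeltaLocal F E c v 2 (JD := J₂D)))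
    (μF : Measure (v.adicCompletion F)) (μR : Measure (UnitaryGroup.LocalRing E v)) [SFinite μF] [SFinite μR]
    (cN : ℝ≥0) (hν : νN = (cN : ℝ≥0∞) • Measure.map e.toMeasurableEquiv (μF.prod (μR.prod μF)))
    (f : UnitaryGroup.localPi E c (2 + 2) J₂D v → ℂ) (h : UnitaryGroup.localPi E c (2 + 2) J₂D v)
    (W : v.adicCompletion F → ℂ) (hW : Continuous W) (hW1 : ∀ x, ‖W x‖ ≤ 1)
    (hmeas : AEStronglyMeasurable (fun p : v.adicCompletion F × (UnitaryGroup.LocalRing E v × v.adicCompletion F) =>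
      f (FrameTransport.frameConj F E c v (2 + 2) hJ₂D (antidiagonal_over_eq_map F E 2) Q hQ (toLocalFour F E c v (weylTwo (UnitaryGroup.LocalRing E v) (UnitaryGroup.conjLocal E c v))) * FrameTransport.frameConj F E c v (2 + 2) hJ₂D (antidiagonal_over_eq_map F E 2) Q hQ (toLocalFour F E c v (uLongTwo (UnitaryGroup.LocalRing E v) (UnitaryGroup.conjLocal E c v) (UnitaryGroup.toLocalRing E v p.2.2 * algebraMap E (UnitaryGroup.LocalRing E v) δ) (conjLocal_coord F E c hcδ v p.2.2))) *
          (FrameTransport.frameConj F E c v (2 + 2) hJ₂D (antidiagonal_over_eq_map F E 2) Q hQ (toLocalFour F E c v (weylOne (UnitaryGroup.LocalRing E v) (UnitaryGroup.conjLocal E c v))) * FrameTransport.frameConj F E c v (2 + 2) hJ₂D (antidiagonal_over_eq_map F E 2) Q hQ (toLocalFour F E c v (uMinus (UnitaryGroup.LocalRing E v) (UnitaryGroup.conjLocal E c v) (UnitaryGroup.conjLocal_conjLocal c v hcδ hδ) p.2.1)) *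
            (FrameTransport.frameConj F E c v (2 + 2) hJ₂D (antidiagonal_over_eq_map F E 2) Q hQ (toLocalFour F E c v (weylTwo (UnitaryGroup.LocalRing E v) (UnitaryGroup.conjLocal E c v))) * FrameTransport.frameConj F E c v (2 + 2) hJ₂D (antidiagonal_over_eq_map F E 2) Q hQ (toLocalFour F E c v (uLongTwo (UnitaryGroup.LocalRing E v) (UnitaryGroup.conjLocal E c v) (UnitaryGroup.toLocalRing E v p.1 * algebraMap E (UnitaryGroup.LocalRing E v) δ) (conjLocal_coord F E c hcδ v p.1))) * h)))) (μF.prod (μR.prod μF)))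
    (hI1 : ∀ g : UnitaryGroup.localPi E c (2 + 2) J₂D v, Integrable (fun y : v.adicCompletion F => ‖f (FrameTransport.frameConj F E c v (2 + 2) hJ₂D (antidiagonal_over_eq_map F E 2) Q hQ (toLocalFour F E c v (weylTwo (UnitaryGroup.LocalRing E v) (UnitaryGroup.conjLocal E c v))) * FrameTransport.frameConj F E c v (2 + 2) hJ₂D (antidiagonal_over_eq_map F E 2) Q hQ (toLocalFour F E c v (uLongTwo (UnitaryGroup.LocalRing E v) (UnitaryGroup.conjLocal E c v) (UnitaryGroup.toLocalRing E v y * algebraMap E (UnitaryGroup.LocalRing E v) δ) (conjLocal_coord F E c hcδ v y))) * g)‖) μF)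
    (hI2 : ∀ g' : UnitaryGroup.localPi E c (2 + 2) J₂D v, Integrable (fun z : UnitaryGroup.LocalRing E v =>
      ∫ y, ‖f (FrameTransport.frameConj F E c v (2 + 2) hJ₂D (antidiagonal_over_eq_map F E 2) Q hQ (toLocalFour F E c v (weylTwo (UnitaryGroup.LocalRing E v) (UnitaryGroup.conjLocal E c v))) * FrameTransport.frameConj F E c v (2 + 2) hJ₂D (antidiagonal_over_eq_map F E 2) Q hQ (toLocalFour F E c v (uLongTwo (UnitaryGroup.LocalRing E v) (UnitaryGroup.conjLocal E c v) (UnitaryGroup.toLocalRing E v y * algebraMap E (UnitaryGroup.LocalRing E v) δ) (conjLocal_coord F E c hcδ v y))) * (FrameTransport.frameConj F E c v (2 + 2) hJ₂D (antidiagonal_over_eq_map F E 2) Q hQ (toLocalFour F E c v (weylOne (UnitaryGroup.LocalRing E v) (UnitaryGroup.conjLocal E c v))) * FrameTransport.frameConj F E c v (2 + 2) hJ₂D (antidiagonal_over_eq_map F E 2) Q hQ (toLocalFour F E c v (uMinus (UnitaryGroup.LocalRing E v) (UnitaryGroup.conjLocal E c v) (UnitaryGroup.conjLocal_conjLocal c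 v hcδ hδ) z)) * g'))‖ ∂μF) μR)
    (hI3 : Integrable (fun x : v.adicCompletion F => ∫ z, ∫ y, ‖f (FrameTransport.frameConj F E c v (2 + 2) hJ₂D (antidiagonal_over_eq_map F E 2) Q hQ (toLocalFour F E c v (weylTwo (UnitaryGroup.LocalRing E v) (UnitaryGroup.conjLocal E c v))) * FrameTransport.frameConj F E c v (2 + 2) hJ₂D (antidiagonal_over_eq_map F E 2) Q hQ (toLocalFour F E c v (uLongTwo (UnitaryGroup.LocalRing E v) (UnitaryGroup.conjLocal E c v) (UnitaryGroup.toLocalRing E v y * algebraMap E (UnitaryGroup.LocalRing E v) δ) (conjLocal_coord F E c hcδ v y))) *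
      (FrameTransport.frameConj F E c v (2 + 2) hJ₂D (antidiagonal_over_eq_map F E 2) Q hQ (toLocalFour F E c v (weylOne (UnitaryGroup.LocalRing E v) (UnitaryGroup.conjLocal E c v))) * FrameTransport.frameConj F E c v (2 + 2) hJ₂D (antidiagonal_over_eq_map F E 2) Q hQ (toLocalFour F E c v (uMinus (UnitaryGroup.LocalRing E v) (UnitaryGroup.conjLocal E c v) (UnitaryGroup.conjLocal_conjLocal c v hcδ hδ) z)) * (FrameTransport.frameConj F E c v (2 + 2) hJ₂D (antidiagonal_over_eq_map F E 2) Q hQ (toLocalFour F E c v (weylTwo (UnitaryGroup.LocalRing E v) (UnitaryGroup.conjLocal E c v))) * FrameTransport.frameConj F E c v (2 + 2) hJ₂D (antidiagonal_over_eq_map F E 2) Q hQ (toLocalFour F E c v (uLongTwo (UnitaryGroup.LocalRing E v) (UnitaryGroup.conjLocal E c v) (UnitaryGroup.toLocalRing E v x * algebraMap E (UnitaryGroup.LocalRing E v) δ) (conjLocal_coord F E c hcδ v x))) * h)))‖ ∂μF ∂μR) μF) :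
    Integrable (fun u : unipDeltaLocal F E c v 2 (JD := J₂D) => W (e.symm u).1 * f (FrameTransport.frameConj F E c v (2 + 2) hJ₂D (antidiagonal_over_eq_map F E 2) Q hQ (toLocalFour F E c v (weylSiegel (UnitaryGroup.LocalRing E v) (UnitaryGroup.conjLocal E c v))) * (u : UnitaryGroup.localPi E c (2 + 2) J₂D v) * h)) νN ∧
      ∫ u, W (e.symm u).1 * f (FrameTransport.frameConj F E c v (2 + 2) hJ₂D (antidiagonal_over_eq_map F E 2) Q hQ (toLocalFour F E c v (weylSiegel (UnitaryGroup.LocalRing E v) (UnitaryGroup.conjLocal E c v))) * (u : UnitaryGroup.localPi E c (2 + 2) J₂D v) * h) ∂νN =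
        ((cN : ℝ) : ℂ) *
          ∫ x, W x * ∫ z, ∫ y, f (FrameTransport.frameConj F E c v (2 + 2) hJ₂D (antidiagonal_over_eq_map F E 2) Q hQ (toLocalFour F E c v (weylTwo (UnitaryGroup.LocalRing E v) (UnitaryGroup.conjLocal E c v))) * FrameTransport.frameConj F E c v (2 + 2) hJ₂D (antidiagonal_over_eq_map F E 2) Q hQ (toLocalFour F E c v (uLongTwo (UnitaryGroup.LocalRing E v) (UnitaryGroup.conjLocal E c v) (UnitaryGroup.toLocalRing E v y * algebraMap E (UnitaryGroup.LocalRing E v) δ) (conjLocal_coord F E c hcδ v y))) *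
          (FrameTransport.frameConj F E c v (2 + 2) hJ₂D (antidiagonal_over_eq_map F E 2) Q hQ (toLocalFour F E c v (weylOne (UnitaryGroup.LocalRing E v) (UnitaryGroup.conjLocal E c v))) * FrameTransport.frameConj F E c v (2 + 2) hJ₂D (antidiagonal_over_eq_map F E 2) Q hQ (toLocalFour F E c v (uMinus (UnitaryGroup.LocalRing E v) (UnitaryGroup.conjLocal E c v) (UnitaryGroup.conjLocal_conjLocal c v hcδ hδ) z)) *
            (FrameTransport.frameConj F E c v (2 + 2) hJ₂D (antidiagonal_over_eq_map F E 2) Q hQ (toLocalFour F E c v (weylTwo (UnitaryGroup.LocalRing E v) (UnitaryGroup.conjLocal E c v))) * FrameTransport.frameConj F E c v (2 + 2) hJ₂D (antidiagonal_over_eq_map F E 2) Q hQ (toLocalFour F E c v (uLongTwo (UnitaryGroup.LocalRing E v) (UnitaryGroup.conjLocal E c v) (UnitaryGroup.toLocalRing E v x * algebraMap E (UnitaryGroup.LocalRing E v) δ) (conjLocal_coord F E c hcδ v x))) * h))) ∂μF ∂μR ∂μF := by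
  have hword : ∀ (x : v.adicCompletion F) (z : UnitaryGroup.LocalRing E v) (y : v.adicCompletion F),
      FrameTransport.frameConj F E c v (2 + 2) hJ₂D (antidiagonal_over_eq_map F E 2) Q hQ (toLocalFour F E c v (weylSiegel (UnitaryGroup.LocalRing E v) (UnitaryGroup.conjLocal E c v))) * ((e.toMeasurableEquiv (x, (z, y)) : unipDeltaLocal F E c v 2 (JD := J₂D)) : UnitaryGroup.localPi E c (2 + 2) J₂D v) =
        FrameTransport.frameConj F E c v (2 + 2) hJ₂D (antidiagonal_over_eq_map F E 2) Q hQ (toLocalFour F E c v (weylTwo (UnitaryGroup.LocalRing E v) (UnitaryGroup.conjLocal E c v))) * FrameTransport.frameConj F E c v (2 + 2) hJ₂D (antidiagonal_over_eq_map F E 2) Q hQ (toLocalFour F E c v (uLongTwo (UnitaryGroup.LocalRing E v) (UnitaryGroup.conjLocal E c v) (UnitaryGroup.toLocalRing E v y * algebraMap E (UnitaryGroup.LocalRing E v) δ) (conjLocal_coord F E c hcδ v y))) *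
          (FrameTransport.frameConj F E c v (2 + 2) hJ₂D (antidiagonal_over_eq_map F E 2) Q hQ (toLocalFour F E c v (weylOne (UnitaryGroup.LocalRing E v) (UnitaryGroup.conjLocal E c v))) * FrameTransport.frameConj F E c v (2 + 2) hJ₂D (antidiagonal_over_eq_map F E 2) Q hQ (toLocalFour F E c v (uMinus (UnitaryGroup.LocalRing E v) (UnitaryGroup.conjLocal E c v) (UnitaryGroup.conjLocal_conjLocal c v hcδ hδ) z))) *
          (FrameTransport.frameConj F E c v (2 + 2) hJ₂D (antidiagonal_over_eq_map F E 2) Q hQ (toLocalFour F E c v (weylTwo (UnitaryGroup.LocalRing E v) (UnitaryGroup.conjLocal E c v))) * FrameTransport.frameConj F E c v (2 + 2) hJ₂D (antidiagonal_over_eq_map F E 2) Q hQ (toLocalFour F E c v (uLongTwo (UnitaryGroup.LocalRing E v) (UnitaryGroup.conjLocal E c v) (UnitaryGroup.toLocalRing E v x * algebraMap E (UnitaryGroup.LocalRing E v) δ) (conjLocal_coord F E c hcδ v x)))) := by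
    intro x z y
    rw [Homeomorph.toMeasurableEquiv_coe, he, frameConj_weylSiegel_mul_coord F E c hcδ hδ v hJ₂D Q hQ]
  have h := integral_comp_eq_iterated_of_chain_weighted νN μF μR μF (fun u : unipDeltaLocal F E c v 2 (JD := J₂D) => (u : UnitaryGroup.localPi E c (2 + 2) J₂D v))
    e.toMeasurableEquiv _ _ _ _ _ hν ENNReal.coe_ne_top hword f h W hW.measurable hW1 hmeas hI1 hI2 hI3
  rwa [ENNReal.coe_toReal] at h

end Concrete

end Summit.HodgeConjecture.HodgeConjecture.Cruxes.HLiu418.K2LiuSiegelIntertwiningCocycleWeighted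

end
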